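import Summits.NavierStokesRegularity.NavierStokesRegularity.Theorems.AxisymmetricExtremalityAxisymmetricKatoGlobalStubSeregin2020TypeIILemma22SublevelEnergyShape
import HarnessLib

/-!
# Seregin 2020, Lemma 2.2 (after Nazarov–Uraltseva 2012): N–U Lemma 3.3 (shrinking levels) in
# Seregin's class 𝒱 — the atom `stub_L33_shrinking` of the De Giorgi skeleton, from the
# energy-inequality class

Helper toward the stub `stub_seregin2020TypeII` of the crux `AxisymmetricKatoGlobal` (= the named
fact `Literature.Analysis.FluidPDE.Seregin2020_axisymmetricSingularPoint_typeII`, Seregin 2020,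
Thm 2.1), reduced in the tree to the written-out hypothesis `hWH′` (= N–U 2012 Lemma 4.2 for the
class 𝒱). The cell's De Giorgi skeleton
`Cruxes/AxisymmetricKatoGlobal/Seregin2020Lemma22ExpansionOfPositivity.lean` (seat c) cuts N–U's
«expansion of positivity» (Cor 3.3) into three atoms over standing hypotheses `Standing Φ U S k R N`;
this file proves the atom **L3.3′ (shrinking lemma)** with the standing hypotheses it uses
written out (`0 < R`, `Measurable (uncurry Φ)`, `Φ ≥ 0`, `U` a.e.-strongly measurable on the
slab `]-R², 0[ × B(2R)`, a.e.-`t` `C¹` slices, the `L_{3,4}` drift bound, and the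
energy-inequality class `EnergyClass Φ U k R` with its right-hand side parenthesised as
`η t₁ (∫ …) + ∫∫ …`): for shape bounds `1 < λ ≤ 2`, `θ ∈ [θmin, θmax]`, a target fraction
`μ ∈ ]0,1[`, a density `δ₁ > 0` and a drift constant `N` there is `s` such that, on every
cylinder `Q = ]t⁰ - θρ², t⁰[ × B(ρ)` of the slab (`R/4 ≤ ρ`, `λρ ≤ 2R`, `t⁰ ≤ 0`) and every
level `0 < κ₀ ≤ k` with `|{Φ(t,·) ≥ κ₀} ∩ B(ρ)| ≥ δ₁|B(ρ)|` for a.e. `t`, the set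
`{Φ < 2^{-s}κ₀}` occupies at most the fraction `μ` of `Q`:

* `L33_shrinking_of_energyClass` — the atom (composition of the measure-theoretic core
  `shrinkingLevels_measure_le`, the slice-gradient measurability
  `aestronglyMeasurable_fderiv_slice_restrict_prod`, and (3.12) in shape form
  `lintegral_fderiv_sq_sublevel_le_shape`; `s = ⌈4C_DG² C/(δ₁²μ²θmin|B₁|³)⌉ + 2`).

The skeleton's `stub_L33_shrinking` is this theorem after projecting `Standing` to the listed
clauses (with the parenthesisation fix of `EnergyClass` recorded in
`pub/ns-inputs/kits/A1-sig-EnergyClass.md`).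

## References

* A. I. Nazarov, N. N. Uraltseva, St. Petersburg Math. J. 23 (2012) 93–115 = arXiv:1011.1888,
  §3, Lemma 3.3 with Remarks 5 and 9. [NazarovUraltseva2012]
* G. Seregin, Anal. Math. Phys. 10 (2020), Paper 46 = arXiv:2006.04140, Lemma 2.2. [Seregin2020]
-/

-- the problem directory repeats the summit name (D-0017); core's `dupNamespace` linter fires
set_option linter.dupNamespace false

noncomputable section

open MeasureTheory Set Function Filter Topology Metric Module
open scoped NNReal ENNReal

namespace Summit.NavierStokesRegularity.NavierStokesRegularity.Theorems.AxisymmetricKatoGlobal.EulerScaling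

open Literature.Analysis.FluidPDE

/-- **Nazarov–Uraltseva 2012, Lemma 3.3 (shrinking levels) in Seregin's class 𝒱 — the atom
`stub_L33_shrinking` of the De Giorgi skeleton, from the energy-inequality class.** See the
module docstring; `EnergyClass` is written out as the hypothesis following the drift bound.
[cite: NazarovUraltseva2012, Lemma 3.3, Remarks 5, 9; Seregin2020, Lemma 2.2] -/
theorem L33_shrinking_of_energyClass :
    ∀ (lam θmin θmax μ δ₁ : ℝ) (N : ℝ≥0), 1 < lam → lam ≤ 2 → 0 < θmin → θmin ≤ θmax →
      0 < μ → μ < 1 → 0 < δ₁ →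
    ∃ s : ℕ,
    ∀ (Φ : ℝ → EuclideanSpace ℝ (Fin 3) → ℝ)
      (U : ℝ → EuclideanSpace ℝ (Fin 3) → EuclideanSpace ℝ (Fin 3)) (k R : ℝ),
      0 < R → Measurable (uncurry Φ) → (∀ t x, 0 ≤ Φ t x) →
      AEStronglyMeasurable (uncurry U)
        (volume.restrict (Ioo (-R ^ 2) 0 ×ˢ ball (0 : EuclideanSpace ℝ (Fin 3)) (2 * R))) →
      (∀ᵐ t : ℝ, t ∈ Ioo (-R ^ 2) 0 → ContDiff ℝ 1 (Φ t)) →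
      (∫⁻ s in Ioo (-R ^ 2) 0, (∫⁻ y in ball (0 : EuclideanSpace ℝ (Fin 3)) (2 * R),
        ‖U s y‖ₑ ^ (3 : ℕ)) ^ (4 / 3 : ℝ) ≤ (N : ℝ≥0∞) * ENNReal.ofReal R ^ 2) →
      (∀ (H : ℝ → ℝ), ContDiff ℝ 2 H → (∀ v, deriv H v ≤ 0) → (∀ v, 0 ≤ H v) →
        (∀ v, 0 ≤ deriv (deriv H) v) → (∀ v, deriv H v ^ 2 ≤ 2 * H v * deriv (deriv H) v) →
        (∀ v, k ≤ v → H v = 0) →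
        ∀ (Θ : EuclideanSpace ℝ (Fin 3) → ℝ), ContDiff ℝ 1 Θ → HasCompactSupport Θ →
          tsupport Θ ⊆ ball (0 : EuclideanSpace ℝ (Fin 3)) (2 * R) →
        ∀ (η : ℝ → ℝ), ContDiff ℝ 1 η → (∀ s, 0 ≤ η s) →
        ∀ (t₁ t₂ : ℝ), -R ^ 2 < t₁ → t₁ ≤ t₂ → t₂ < 0 →
          ENNReal.ofReal (η t₂ * ∫ x, H (Φ t₂ x) * Θ x ^ 2) +
            ∫⁻ z in Icc t₁ t₂ ×ˢ (univ : Set (EuclideanSpace ℝ (Fin 3))), ENNReal.ofReal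
              (1 / 2 * η z.1 * (deriv (deriv H) (Φ z.1 z.2) * ‖gradient (Φ z.1) z.2‖ ^ 2 *
                Θ z.2 ^ 2))
          ≤ ENNReal.ofReal (η t₁ * (∫ x, H (Φ t₁ x) * Θ x ^ 2) +
              ∫ z in Icc t₁ t₂ ×ˢ (univ : Set (EuclideanSpace ℝ (Fin 3))),
                (4 * η z.1 * (H (Φ z.1 z.2) * ‖gradient Θ z.2‖ ^ 2) +
                  η z.1 * (H (Φ z.1 z.2) * inner ℝ (U z.1 z.2) (gradient (fun y => Θ y ^ 2) z.2)) +
                  η z.1 * (2 / cylRadius z.2 *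
                    (H (Φ z.1 z.2) * fderiv ℝ (fun y => Θ y ^ 2) z.2 (eR z.2))) +
                  |deriv η z.1| * (H (Φ z.1 z.2) * Θ z.2 ^ 2)))) →
    ∀ (ρ θ t₀ κ₀ : ℝ), R / 4 ≤ ρ → lam * ρ ≤ 2 * R → θmin ≤ θ → θ ≤ θmax →
      t₀ ≤ 0 → -R ^ 2 < t₀ - θ * ρ ^ 2 → 0 < κ₀ → κ₀ ≤ k →
      (∀ᵐ t ∂(volume.restrict (Ioo (t₀ - θ * ρ ^ 2) t₀)),
        ENNReal.ofReal δ₁ * volume (ball (0 : EuclideanSpace ℝ (Fin 3)) ρ) ≤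
          volume {x : EuclideanSpace ℝ (Fin 3) | x ∈ ball (0 : EuclideanSpace ℝ (Fin 3)) ρ ∧
            κ₀ ≤ Φ t x}) →
      volume {z : ℝ × EuclideanSpace ℝ (Fin 3) |
          z ∈ Ioo (t₀ - θ * ρ ^ 2) t₀ ×ˢ ball (0 : EuclideanSpace ℝ (Fin 3)) ρ ∧
            Φ z.1 z.2 < (2 : ℝ)⁻¹ ^ s * κ₀} ≤
        ENNReal.ofReal μ * volume (Ioo (t₀ - θ * ρ ^ 2) t₀ ×ˢ ball (0 : EuclideanSpace ℝ (Fin 3)) ρ) := by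
  intro lam θmin θmax μ δ₁ N hlam hlam2 hθmin hθmm hμ hμ1 hδ₁
  have hθmax : 0 < θmax := hθmin.trans_le hθmm
  obtain ⟨C, hC0, hC⟩ := lintegral_fderiv_sq_sublevel_le_shape lam θmax N hlam hlam2 hθmax
  set V₁ : ℝ := (volume (ball (0 : EuclideanSpace ℝ (Fin 3)) 1)).toReal with hV₁
  have hV₁pos : 0 < V₁ :=
    ENNReal.toReal_pos (measure_ball_pos _ _ one_pos).ne' measure_ball_lt_top.ne
  set K₀ : ℝ := 4 * (64 * Real.pi / 3) ^ 2 * C / (δ₁ ^ 2 * μ ^ 2 * θmin * V₁ ^ 3) with hK₀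
  set s₀ : ℕ := ⌈K₀⌉₊ + 1 with hs₀
  refine ⟨s₀ + 1, ?_⟩
  intro Φ U k R hR hΦm hΦ0 hU hC1 hdrift hEC ρ θ t₀ κ₀ hρR hlamρ hθ1 hθ2 ht₀ hbot hκ₀ hκ₀k hdens
  have hρ : 0 < ρ := by linarith
  have hθ : 0 < θ := hθmin.trans_le hθ1
  set a : ℝ := t₀ - θ * ρ ^ 2 with ha
  have hat : a < t₀ := by
    have : 0 < θ * ρ ^ 2 := by positivity
    rw [ha]; linarith
  -- ### the hypotheses of the measure-theoretic core
  have hΦm' : AEStronglyMeasurable (uncurry Φ)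
      (volume.restrict (Ioo a t₀ ×ˢ ball (0 : EuclideanSpace ℝ (Fin 3)) ρ)) :=
    hΦm.aestronglyMeasurable
  have hgood : ∀ᵐ t ∂(volume.restrict (Ioo a t₀)), ContDiff ℝ 1 (Φ t) := by
    filter_upwards [ae_restrict_mem measurableSet_Ioo, ae_restrict_of_ae hC1] with t ht h
    exact h ⟨hbot.trans ht.1, ht.2.trans_le ht₀⟩
  have hDm : AEStronglyMeasurable
      (fun z : ℝ × EuclideanSpace ℝ (Fin 3) => fderiv ℝ (Φ z.1) z.2)
      (volume.restrict (Ioo a t₀ ×ˢ ball (0 : EuclideanSpace ℝ (Fin 3)) ρ)) :=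
    aestronglyMeasurable_fderiv_slice_restrict_prod hΦm
      (hgood.mono fun t ht => ht.differentiable one_ne_zero)
  have hC1' : ∀ᵐ t ∂(volume.restrict (Ioo a t₀)),
      ContDiffOn ℝ 1 (Φ t) (ball (0 : EuclideanSpace ℝ (Fin 3)) ρ ∩ {x | cylRadius x ≠ 0}) :=
    hgood.mono fun t ht => ht.contDiffOn
  have hδ' : ∀ᵐ t ∂(volume.restrict (Ioo a t₀)),
      ENNReal.ofReal δ₁ * volume (ball (0 : EuclideanSpace ℝ (Fin 3)) ρ) ≤
        volume (ball (0 : EuclideanSpace ℝ (Fin 3)) ρ ∩ {x | κ₀ ≤ Φ t x}) := by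
    filter_upwards [hdens] with t ht
    simpa only [inter_def, mem_setOf_eq] using ht
  have hE' : ∀ m : ℕ, 1 ≤ m →
      ∫⁻ z in (Ioo a t₀ ×ˢ ball (0 : EuclideanSpace ℝ (Fin 3)) ρ) ∩ {z | Φ z.1 z.2 < κ₀ / 2 ^ m},
        ‖fderiv ℝ (Φ z.1) z.2‖ₑ ^ 2 ≤ ENNReal.ofReal (C * (κ₀ / 2 ^ m) ^ 2 * ρ ^ 3) := by
    intro m hm
    have hl : 0 < κ₀ / 2 ^ m := by positivity
    have h2m : (2 : ℝ) ≤ 2 ^ m := by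
      calc (2 : ℝ) = 2 ^ 1 := by norm_num
        _ ≤ 2 ^ m := pow_le_pow_right₀ (by norm_num) hm
    have h2l : 2 * (κ₀ / 2 ^ m) ≤ k := by
      have h1 : 2 * (κ₀ / 2 ^ m) ≤ κ₀ := by
        rw [mul_div_assoc', div_le_iff₀ (by positivity)]
        nlinarith
      linarith
    exact hC Φ U k R hR hΦm hΦ0 hU hdrift hEC ρ θ t₀ (κ₀ / 2 ^ m) hρR hlamρ hθ hθ2 ht₀ hbot hl h2l
  -- ### the choice of `s`
  have hs₀pos : 0 < s₀ := Nat.succ_pos _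
  have hsK : 4 * (64 * Real.pi / 3) ^ 2 * C * ρ ^ 2 /
      (δ₁ ^ 2 * μ ^ 2 * (t₀ - a) * (volume (ball (0 : EuclideanSpace ℝ (Fin 3)) 1)).toReal ^ 3)
        ≤ s₀ := by
    have hta : t₀ - a = θ * ρ ^ 2 := by rw [ha]; ring
    rw [hta, ← hV₁]
    have hnum : 0 ≤ 4 * (64 * Real.pi / 3) ^ 2 * C := by positivity
    calc 4 * (64 * Real.pi / 3) ^ 2 * C * ρ ^ 2 / (δ₁ ^ 2 * μ ^ 2 * (θ * ρ ^ 2) * V₁ ^ 3)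
        = 4 * (64 * Real.pi / 3) ^ 2 * C / (δ₁ ^ 2 * μ ^ 2 * θ * V₁ ^ 3) := by
          field_simp
      _ ≤ K₀ := by
          rw [hK₀]
          exact div_le_div_of_nonneg_left hnum (by positivity) (by gcongr)
      _ ≤ (⌈K₀⌉₊ : ℝ) := Nat.le_ceil _
      _ ≤ (s₀ : ℝ) := by rw [hs₀]; push_cast; linarith
  have hcore := shrinkingLevels_measure_le Φ 0 ρ a t₀ κ₀ δ₁ C hρ hat hκ₀ hδ₁ hC0 hΦm' hDm hC1'
    hδ' hE' hμ hs₀pos hsK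
  -- ### the level `2^{-(s₀+1)} κ₀` and the set
  have hlev : (2 : ℝ)⁻¹ ^ (s₀ + 1) * κ₀ = κ₀ / 2 ^ (s₀ + 1) := by
    rw [inv_pow]; field_simp
  simp_rw [hlev]
  simpa only [inter_def, mem_setOf_eq] using hcore

end Summit.NavierStokesRegularity.NavierStokesRegularity.Theorems.AxisymmetricKatoGlobal.EulerScaling

end
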